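/-
Copyright (c) 2026 the pub-hodgecm-mathlib formalisation cell (harness21).  Prover seat hodgecm-mathlib-F0P3a-p01 (g15), 2026-09-01.  Road «S3-ram» (LEAD F0P3a-plan (g12)
T11-50 (2) ∕ T11-52 (2); owner F0P3a-p06 (g15)): organ (e3) «LEVI-ram CLAUSE» — the assembly CORE in socket form ((e3)-second; holder F0P3a-p07 (g12)).
-/
import Literature.NumberTheory.Rogawski1990.DepthZeroTransferHValuesLeviFrameRamified   -- ★ p846841 (p07 (g12)): `stableOrbitalIntegralRel_chi_combination_of_levi_ramified`; ⊇ ★ p846823, ★ `UnitFundamentalLemmaInertLeviClause`, ★ `LocalDeltaTransferLeviStratum`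
import Literature.NumberTheory.Rogawski1990.LeviTransferPrefactor                     -- ★ p846585 (O4): `levi_prefactor_eq`; ⊇ ★ `FinExplicitTransferFactorLeviStratum` (`localNonsplitCongr` frame kit, Levi-stratum bookkeeping)
import Literature.NumberTheory.Rogawski1990.FinExplicitTransferFactorStableInvariance  -- ★ `finExplicitCollection_Δ_eq_of_isLocalStablyConjH`
import Literature.NumberTheory.Rogawski1990.UnitFundamentalLemmaInertFlickerFrame       -- ★ `isUnit_two_integer_iff_valued_eq_one`
import Literature.NumberTheory.Automorphic.TorusDeepOrbitalIntegralStrata              -- ★ p846544: `torus_three_mem_cmLocalIntegralLevel_of_deep`; the `J₃` token of the (O2) socket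
import HarnessLib

/-!
# The LEVI ROW of the depth-zero Δ‴-transfer at a TAME-RAMIFIED non-split place, as a CORE over two sockets (Rogawski (1990) §4.9 Prop. 4.9.1, §4.3 (4.3.1))

Topic `NumberTheory/Rogawski1990`; namespace `Literature.NumberTheory.Rogawski1990`.  KERNEL mathematics only: theorems, no definition, no named fact, no
instance, no notation, no `sorry`.  Cell `pub/hodgecm-mathlib`, crux H413 = `stmt-HodgeConjecture-24833`; road «S3-ram» (Literature seeding, LEAD F0P3a-plan (g12)
T11-50 (2) ∕ T11-52 (2), owner F0P3a-p06 (g15)), organ **(e3) «LEVI-ram CLAUSE»**: the ramified twin of ★ p846740 `finsum_delta_mul_classOrbitalIntegral_eq_of_levi_of_orbital_eq`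
(F0P3-p02 (g15)) proved along the route of ★ p846693 `depthZeroKappaTransfer_hyperspecial_levi` (this seat).  CONSUMER: the Levi population of END's `stub_rowsRam` ∕ the
`_le_one`-ram waypoint (END F0P3a-p03 (g16), fold v2 daaa807d), assembled by p07 (g12) from this core + ★ (O2)-ram (`TorusDeepOrbitalIntegralStrataRamified`, p07) + the
C-Δram Levi value (F0P3b-p01 (g12)).  HONEST LABEL: HC_CM is proved only modulo the cell's 2 remaining named inputs (hLiu418 24832, h413 24833) until rung 0 closes;
«S3-ram» has no books consequence; this file is unconditional and discharges nothing by itself.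

THE MATHEMATICS.  `L` CM, `v` a finite place of `L⁺` NON-SPLIT (`hw`) and TAMELY RAMIFIED (`he`, `v ∤ 2`: `h2`) in `L`, `H′` hermitian with good reduction at `w`
(`hH′w hH′i`) and an integral antidiagonal frame `H′_w = (−det H′_w)·ᵗĀ Φ₃ A`, `A ∈ GL₃(𝒪_w)` (`hframe`; ★ p846344 at a tame-ramified `w`), canonical families `m_H`, `m_G`.
Let `γ_H ∈ H_v` be `G`-regular, near `1`, `H_v`-conjugate to a LEVI element `γ₁ = yγ_Hy⁻¹`, `γ₁.1 = diag(d′₀, d′₁)` (so `ι_v(γ₁) = t = diag(d′₀, u, d′₁) ∈ T` regular and deep).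
SOCKETS: (O2)-ram — through any level frame `ψ`, `Φ(⟦ψ⁻¹t⟧, g) = ν_G(K′)·J₃(t)·X`, `J₃(t) = χ(a − 1)⁻¹·χ⁻(b − 1)⁻¹`, `a = d′₀⁻¹u`, `b = d′₀⁻¹d′₁`; C-Δram — near `1`,
`Δ‴_v(γ₁, γ₀) = ε·‖a − 1‖` at every match `γ₀`.  THEN, exactly as at an inert place but with the RAMIFIED `H`-side rows ★ p846841 (`Φ^st(γ_H, χ₀) = ν_H(K_H)·J_H(γ₁)`,
`Φ^st(γ_H, χ₁) = 0`, `J_H = χ⁻(b − 1)⁻¹`): `Σᶠ_c Δ‴_v(γ_H, c)·Φ(c, g) = Δ‴(γ₁, ψ⁻¹t)·Φ(⟦ψ⁻¹t⟧, g)` (ONE matching class ★, `Δ‴` a stable class function ★)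
`= ε‖a − 1‖·ν_G(K′)·J₃(t)·X = ε·ν_G(K′)·X·J_H(γ₁)` (★ `levi_prefactor_eq`: `‖a − 1‖·J₃(t) = J_H`), while `a₀Φ^st(γ_H, χ₀) + a₁Φ^st(γ_H, χ₁) = a₀·ν_H(K_H)·J_H(γ₁)`; hence the
two-row identity holds for every `a₀, a₁` with **`a₀·ν_H(K_H) = ε·ν_G(K′)·X`** (`a₁` free).  §0 is the place-generic level frame `ψ` built from the binder `hframe`
(★ `localNonsplitCongr` with the scalar `(−det H′_w)⁻¹`), the `hv`-free replacement of ★ `exists_continuousMulEquiv_level_formCongr_of_nonsplit`.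

## References
* [Rogawski1990] J. D. Rogawski, *Automorphic Representations of Unitary Groups in Three Variables*, Ann. of Math. Stud. 123 (1990), §4.9 Prop. 4.9.1 (a)(b), (4.9.2) pp. 54–56;
  §4.3 (4.3.1) p. 43; §14.2 p. 233.
* [LanglandsShelstad1987] R. P. Langlands, D. Shelstad, *On the definition of transfer factors*, Math. Ann. 278 (1987), §1.3–1.4.
* [Kottwitz1986] R. E. Kottwitz, *Base change for unit elements of Hecke algebras*, Compositio Math. 60 (1986), §3, §7.
* [Jacobowitz1962] R. Jacobowitz, *Hermitian forms over local fields*, Amer. J. Math. 84 (1962), §7.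
-/

set_option autoImplicit false

noncomputable section

open NumberField IsDedekindDomain MeasureTheory Measure Topology Filter Matrix
open Literature.NumberTheory.Automorphic Literature.NumberTheory.Automorphic.UnitaryGroup Literature.NumberTheory.Automorphic.IntegralReduction
open Literature.NumberTheory.GaloisRepresentations
open scoped Matrix MatrixGroups NNReal ENNReal ValuativeRel

namespace Literature.NumberTheory.Rogawski1990

/-- The scalar exit of the ramified Levi row: `ε‖a−1‖·(ν_G·J₃·X) = a₀·(ν_H·J_H)` when `‖a−1‖·J₃ = J_H` and `a₀·ν_H = ε·ν_G·X`.
[cite: Rogawski1990, §4.9 Prop. 4.9.1 (b) p. 55] -/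
theorem levi_ramified_row_scalar_identity {α J JH νG νH X ε a₀ : ℂ} (hpref : α * J = JH) (ha : a₀ * νH = ε * νG * X) :
    ε * α * (νG * J * X) = a₀ * (νH * JH) := by
  rw [← hpref]
  linear_combination (-(α * J)) * ha

/-- `IsConj` descends along a multiplicative equivalence. [cite: Rogawski1990, §3.1 p. 19] -/
private theorem isConj_of_isConj_mulEquiv_frame {G G' : Type*} [Monoid G] [Monoid G'] (e : G ≃* G') {a b : G}
    (h : IsConj (e a) (e b)) : IsConj a b := by
  have h' := MonoidHom.map_isConj e.symm.toMonoidHom h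
  simpa using h'

/-! ## §0 The level-preserving frame `ψ : U(H′)(L⁺_v) ≃ U(Φ₃)(L⁺_v)` from an integral antidiagonal frame binder (place-generic) -/

/-- **THE LEVEL FRAME FROM THE BINDER `hframe`** (the `hv`-free twin of ★ `exists_continuousMulEquiv_level_formCongr_of_nonsplit`): if
`H′_w = (−det H′_w)·ᵗĀ·Φ₃·A` with `A ∈ GL₃(𝒪_w)` at a non-split `w`, then `ψ :=` ★ `localNonsplitCongr` (scalar `(−det H′_w)⁻¹`, `(ψ g)_w = A g_w A⁻¹`) is a
topological-group isomorphism `U(H′)(L⁺_v) ≃ U(Φ₃)(L⁺_v)` preserving the hyperspecial levels, with `ψ g ∼ g` in `GL₃(∏_{w′∣v} L_{w′})`.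
[cite: Rogawski1990, §14.2 p. 233] [cite: Jacobowitz1962, §7 Thm. 7.1] -/
theorem exists_continuousMulEquiv_level_of_frame (L : Type) [Field L] [NumberField L] [IsCMField L]
    (H' : Matrix (Fin 3) (Fin 3) L) {v : HeightOneSpectrum (𝓞 ↥(maximalRealSubfield L))} (w : PlacesOver L v)
    (hw : IsCMField.complexConj L • w.1 = w.1) (hH'w : IsUnit (placeForm H' w.1))
    (A : GL (Fin 3) (w.1.adicCompletion L)) (hA : A ∈ glInt 3 (w.1.adicCompletion L))
    (hframe : placeForm H' w.1 = (-(placeForm H' w.1).det) •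
      formCongr (galAdicCompletionMap (L := L) (IsCMField.complexConj L) hw) A ((StdForm.antidiagonal 3).over (w.1.adicCompletion L))) :
    ∃ ψ : (cmDatum L 3 H').Local v ≃ₜ* ↥(unitaryGroupOfForm (conjLocal L (IsCMField.complexConj L) v) (cmLocalForm L 3 v)),
      (∀ g, ψ g ∈ cmLocalIntegralLevel L 3 (Matrix.of fun i j : Fin 3 => if i.val + j.val + 1 = 3 then (1 : L) else 0) v ↔
          g ∈ cmLocalIntegralLevel L 3 H' v) ∧
      (∀ g, IsConj ((g.val : GL (Fin 3) (LocalRing L v)))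
          (((ψ g : ↥(unitaryGroupOfForm (conjLocal L (IsCMField.complexConj L) v) (cmLocalForm L 3 v))) : GL (Fin 3) (LocalRing L v)))) ∧
      ∀ g, localGLPiEquiv L 3 v
          (((ψ g : ↥(unitaryGroupOfForm (conjLocal L (IsCMField.complexConj L) v) (cmLocalForm L 3 v))) : GL (Fin 3) (LocalRing L v))) w =
        A * localGLPiEquiv L 3 v (g.val : GL (Fin 3) (LocalRing L v)) w * A⁻¹ := by
  have hc := IsCMField.complexConj_ne_one L
  haveI : Algebra.IsQuadraticExtension ↥(maximalRealSubfield L) L := IsCMField.isQuadraticExtension L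
  have hdet : IsUnit (-(placeForm H' w.1).det) := ((Matrix.isUnit_iff_isUnit_det _).1 hH'w).neg
  have ha : IsUnit (-(placeForm H' w.1).det)⁻¹ := hdet.inv
  have h : formCongr (galAdicCompletionMap (L := L) (IsCMField.complexConj L) hw) A
      (placeForm (Matrix.of fun i j : Fin 3 => if i.val + j.val + 1 = 3 then (1 : L) else 0) w.1) =
        (-(placeForm H' w.1).det)⁻¹ • placeForm H' w.1 := by
    rw [placeForm_antidiagOne]
    calc formCongr (galAdicCompletionMap (L := L) (IsCMField.complexConj L) hw) A ((StdForm.antidiagonal 3).over (w.1.adicCompletion L))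
        = (-(placeForm H' w.1).det)⁻¹ • ((-(placeForm H' w.1).det) •
            formCongr (galAdicCompletionMap (L := L) (IsCMField.complexConj L) hw) A ((StdForm.antidiagonal 3).over (w.1.adicCompletion L))) := by
          rw [smul_smul, inv_mul_cancel₀ hdet.ne_zero, one_smul]
      _ = (-(placeForm H' w.1).det)⁻¹ • placeForm H' w.1 := by rw [← hframe]
  refine ⟨localNonsplitCongr (IsCMField.complexConj L) hc w hw A ha h, fun g => ?_, fun g => ?_, fun g =>
    localNonsplitEquiv_localNonsplitCongr (IsCMField.complexConj L) hc w hw A ha h g⟩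
  · -- level preservation (`A, A⁻¹ ∈ GL₃(𝒪_w)`)
    have e1 := mem_localIntegralLevel_iff_of_smul_eq (IsCMField.complexConj L) 3
      (Matrix.of fun i j : Fin 3 => if i.val + j.val + 1 = 3 then (1 : L) else 0) hc w hw
      (localNonsplitCongr (IsCMField.complexConj L) hc w hw A ha h g)
    have e2 := mem_localIntegralLevel_iff_of_smul_eq (IsCMField.complexConj L) 3 H' hc w hw g
    refine (e1.trans ?_).trans e2.symm
    rw [localNonsplitEquiv_localNonsplitCongr]
    constructor
    · intro h'
      have h'' := Subgroup.mul_mem _ (Subgroup.mul_mem _ (Subgroup.inv_mem _ hA) h') hA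
      simpa only [mul_assoc, mul_inv_cancel_left, inv_mul_cancel, mul_one, inv_mul_cancel_left] using h''
    · intro h'
      exact Subgroup.mul_mem _ (Subgroup.mul_mem _ hA h') (Subgroup.inv_mem _ hA)
  · -- conjugacy in `GL₃(∏ L_{w′})` from the one-component conjugacy
    refine isConj_of_isConj_mulEquiv_frame
      ((localGLPiEquiv L 3 v).toMulEquiv.trans (localGLPiEvalEquiv (IsCMField.complexConj L) 3 hc w hw).toMulEquiv) ?_
    show IsConj (localGLPiEquiv L 3 v (g.val : GL (Fin 3) (LocalRing L v)) w)
      (localGLPiEquiv L 3 v (((localNonsplitCongr (IsCMField.complexConj L) hc w hw A ha h g :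
          ↥(unitaryGroupOfForm (conjLocal L (IsCMField.complexConj L) v) (cmLocalForm L 3 v))) : GL (Fin 3) (LocalRing L v))) w)
    have e := localNonsplitEquiv_localNonsplitCongr (IsCMField.complexConj L) hc w hw A ha h g
    change localGLPiEquiv L 3 v _ w = A * localGLPiEquiv L 3 v _ w * A⁻¹ at e
    rw [e]
    exact isConj_iff.2 ⟨A, rfl⟩

/-! ## §1 The CORE: the ramified Levi row over the sockets (O2)-ram and C-Δram -/

set_option maxHeartbeats 1600000 in
-- instance-term unification on the CM local carriers (as in ★ p846740 ∕ ★ p846693)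
open scoped Classical in
/-- **THE LEVI ROW OF THE Δ‴-TRANSFER AT A TAME-RAMIFIED PLACE, AS A CORE OVER TWO SOCKETS** (organ (e3) «LEVI-ram CLAUSE», socket form).  Frame of
★ p846740 with `hv ↦ he`, `hμ hμω` dropped, the frame binders `(A hA hframe)` of END's fold v2 added.  `deep`: a predicate on the three Levi eigenvalues
holding near `1` (`hV`) and implying 1-deepness (`hdeep1`).  SOCKET `hX` ((O2)-ram, binders VERBATIM ★ p846740's): through every level frame `ψ` with
`(ψ g)_w = T g_w T⁻¹`, `T ∈ GL₃(𝒪_w)`, at every regular `deep` split torus `t`, `Φ(⟦ψ⁻¹t⟧, g) = ν_G(K′)·J₃(t)·X`.  SOCKET `hΔ` (C-Δram Levi value, binders =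
★ T5-Levi's): near `1`, `Δ‴_v(yγ_Hy⁻¹, γ₀) = ε·‖d₀⁻¹d₁ − 1‖` at every match `γ₀`.  TEST `ha : a₀·ν_H(K_H) = ε·ν_G(K′)·X` (`a₁` free: the ramified `χ₁`-row
vanishes, ★ p846841).  THEN the Levi row holds near `1` with coefficients `a₀, a₁` against `χ₀, χ₁` (the `stub_rowsRam` indicator texts VERBATIM).
[cite: Rogawski1990, §4.9 Prop. 4.9.1 (a)(b) pp. 54–56; §4.3 (4.3.1) p. 43; §4.1 (4.1.1) p. 40] [cite: LanglandsShelstad1987, §1.3–1.4] [cite: Kottwitz1986, §3] -/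
theorem finsum_delta_mul_classOrbitalIntegral_eq_of_levi_ramified_of_orbital_eq
    (L : Type) [Field L] [NumberField L] [IsCMField L] (H' : Matrix (Fin 3) (Fin 3) L) (μ : HeckeCharacter L)
    {v : HeightOneSpectrum (𝓞 ↥(maximalRealSubfield L))}
    (hH' : (H'.map (cmConjRingHom L)).transpose = H') (w : PlacesOver L v)
    (hw : IsCMField.complexConj L • w.1 = w.1) (he : v.asIdeal.ramificationIdx' w.1.asIdeal ≠ 1)
    -- good reduction (`_hH'i` idle: the frame binder `hframe`∕`hA` below carries the integrality; kept so the binder list is END's socket frame)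
    (hH'w : IsUnit (placeForm H' w.1)) (_hH'i : hH'w.unit ∈ glInt 3 (w.1.adicCompletion L))
    (h2 : IsUnit (2 : 𝒪[w.1.adicCompletion L]))
    -- the integral antidiagonal FRAME of `H′_w` (END fold v2 socket binders; supplied at a tame-ramified `w` by ★ p846344 `exists_glInt_placeForm_eq_smul_formCongr_antidiagonal_of_neg`)
    (A : GL (Fin 3) (w.1.adicCompletion L)) (hA : A ∈ glInt 3 (w.1.adicCompletion L))
    (hframe : placeForm H' w.1 = (-(placeForm H' w.1).det) • formCongr (galAdicCompletionMap (L := L) (IsCMField.complexConj L) hw) A ((StdForm.antidiagonal 3).over (w.1.adicCompletion L)))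
    [MeasurableSpace ((cmDatum L 3 H').Local v)] [BorelSpace ((cmDatum L 3 H').Local v)]
    [∀ γ : ((cmDatum L 3 H').Local v), MeasurableSpace (((cmDatum L 3 H').Local v) ⧸ Subgroup.centralizer ({γ} : Set ((cmDatum L 3 H').Local v)))]
    [∀ γ : ((cmDatum L 3 H').Local v), BorelSpace (((cmDatum L 3 H').Local v) ⧸ Subgroup.centralizer ({γ} : Set ((cmDatum L 3 H').Local v)))]
    [MeasurableSpace ((cmDatum L 2 (Matrix.of fun i j : Fin 2 => if i.val + j.val + 1 = 2 then (1 : L) else 0)).Local v ×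
      (cmDatum L 1 (Matrix.of fun i j : Fin 1 => if i.val + j.val + 1 = 1 then (1 : L) else 0)).Local v)]
    [BorelSpace ((cmDatum L 2 (Matrix.of fun i j : Fin 2 => if i.val + j.val + 1 = 2 then (1 : L) else 0)).Local v ×
      (cmDatum L 1 (Matrix.of fun i j : Fin 1 => if i.val + j.val + 1 = 1 then (1 : L) else 0)).Local v)]
    [∀ a : ((cmDatum L 2 (Matrix.of fun i j : Fin 2 => if i.val + j.val + 1 = 2 then (1 : L) else 0)).Local v ×
      (cmDatum L 1 (Matrix.of fun i j : Fin 1 => if i.val + j.val + 1 = 1 then (1 : L) else 0)).Local v),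
      MeasurableSpace (((cmDatum L 2 (Matrix.of fun i j : Fin 2 => if i.val + j.val + 1 = 2 then (1 : L) else 0)).Local v ×
      (cmDatum L 1 (Matrix.of fun i j : Fin 1 => if i.val + j.val + 1 = 1 then (1 : L) else 0)).Local v) ⧸ Subgroup.centralizer ({a} : Set ((cmDatum L 2 (Matrix.of fun i j : Fin 2 => if i.val + j.val + 1 = 2 then (1 : L) else 0)).Local v ×
      (cmDatum L 1 (Matrix.of fun i j : Fin 1 => if i.val + j.val + 1 = 1 then (1 : L) else 0)).Local v)))]
    [∀ a : ((cmDatum L 2 (Matrix.of fun i j : Fin 2 => if i.val + j.val + 1 = 2 then (1 : L) else 0)).Local v ×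
      (cmDatum L 1 (Matrix.of fun i j : Fin 1 => if i.val + j.val + 1 = 1 then (1 : L) else 0)).Local v),
      BorelSpace (((cmDatum L 2 (Matrix.of fun i j : Fin 2 => if i.val + j.val + 1 = 2 then (1 : L) else 0)).Local v ×
      (cmDatum L 1 (Matrix.of fun i j : Fin 1 => if i.val + j.val + 1 = 1 then (1 : L) else 0)).Local v) ⧸ Subgroup.centralizer ({a} : Set ((cmDatum L 2 (Matrix.of fun i j : Fin 2 => if i.val + j.val + 1 = 2 then (1 : L) else 0)).Local v ×
      (cmDatum L 1 (Matrix.of fun i j : Fin 1 => if i.val + j.val + 1 = 1 then (1 : L) else 0)).Local v)))]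
    (νH : Measure ((cmDatum L 2 (Matrix.of fun i j : Fin 2 => if i.val + j.val + 1 = 2 then (1 : L) else 0)).Local v ×
      (cmDatum L 1 (Matrix.of fun i j : Fin 1 => if i.val + j.val + 1 = 1 then (1 : L) else 0)).Local v)) [νH.IsHaarMeasure] [νH.IsMulRightInvariant]
    (νG : Measure ((cmDatum L 3 H').Local v)) [νG.IsHaarMeasure] [νG.IsMulRightInvariant]
    {mH : OrbitalMeasureFamily ((cmDatum L 2 (Matrix.of fun i j : Fin 2 => if i.val + j.val + 1 = 2 then (1 : L) else 0)).Local v ×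
      (cmDatum L 1 (Matrix.of fun i j : Fin 1 => if i.val + j.val + 1 = 1 then (1 : L) else 0)).Local v)} {mG : OrbitalMeasureFamily ((cmDatum L 3 H').Local v)}
    (hmH : mH.IsCanonical (IsLocalGRegular L v) νH)
    (_hmG : mG.IsCanonical (fun γ => IsRegularElt (γ.val : GL (Fin 3) (UnitaryGroup.LocalRing L v))) νG)
    -- the piece (only its `G`-side value `hX` is used)
    (g : ((cmDatum L 3 H').Local v) → ℂ)
    -- the depth predicate on the Levi eigenvalues, holding near `1`, at least 1-deep
    (deep : (Fin 3 → (UnitaryGroup.LocalRing L v)ˣ) → Prop)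
    (hV : ∃ V ∈ 𝓝 (1 : (cmDatum L 2 (Matrix.of fun i j : Fin 2 => if i.val + j.val + 1 = 2 then (1 : L) else 0)).Local v ×
        (cmDatum L 1 (Matrix.of fun i j : Fin 1 => if i.val + j.val + 1 = 1 then (1 : L) else 0)).Local v),
      ∀ γH ∈ V, ∀ (y : (cmDatum L 2 (Matrix.of fun i j : Fin 2 => if i.val + j.val + 1 = 2 then (1 : L) else 0)).Local v ×
        (cmDatum L 1 (Matrix.of fun i j : Fin 1 => if i.val + j.val + 1 = 1 then (1 : L) else 0)).Local v) (d : Fin 3 → (UnitaryGroup.LocalRing L v)ˣ),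
        ((endoEmbLocal L v (y * γH * y⁻¹)).val : GL (Fin 3) (UnitaryGroup.LocalRing L v)) = glDiagonal 3 (UnitaryGroup.LocalRing L v) d → deep d)
    (hdeep1 : ∀ d : Fin 3 → (UnitaryGroup.LocalRing L v)ˣ, deep d → ∀ i : Fin 3, Valued.v ((((d i : (UnitaryGroup.LocalRing L v)ˣ) : UnitaryGroup.LocalRing L v) w) - 1) < 1)
    -- SOCKET (O2)-ram: the `G`-side value at the deep regular split torus, through ANY level-preserving frame (binders VERBATIM ★ p846740's `hX`)
    (X a₀ a₁ ε : ℂ)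
    (hX : ∀ [MeasurableSpace ↥(unitaryGroupOfForm (conjLocal L (IsCMField.complexConj L) v) (cmLocalForm L 3 v))] [BorelSpace ↥(unitaryGroupOfForm (conjLocal L (IsCMField.complexConj L) v) (cmLocalForm L 3 v))]
      (ψ : (cmDatum L 3 H').Local v ≃ₜ* ↥(unitaryGroupOfForm (conjLocal L (IsCMField.complexConj L) v) (cmLocalForm L 3 v)))
      (_hψK : ∀ g : (cmDatum L 3 H').Local v, ψ g ∈ cmLocalIntegralLevel L 3 (Matrix.of fun i j : Fin 3 => if i.val + j.val + 1 = 3 then (1 : L) else 0) v ↔ g ∈ cmLocalIntegralLevel L 3 H' v)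
      (_hψc : ∀ g : (cmDatum L 3 H').Local v, IsConj (g.val : GL (Fin 3) (LocalRing L v)) ((ψ g : ↥(unitaryGroupOfForm (conjLocal L (IsCMField.complexConj L) v) (cmLocalForm L 3 v))) : GL (Fin 3) (LocalRing L v)))
      (T : GL (Fin 3) (w.1.adicCompletion L)) (_hT : T ∈ glInt 3 (w.1.adicCompletion L))
      (_hψT : ∀ g : (cmDatum L 3 H').Local v, localGLPiEquiv L 3 v (((ψ g : ↥(unitaryGroupOfForm (conjLocal L (IsCMField.complexConj L) v) (cmLocalForm L 3 v)))) : GL (Fin 3) (LocalRing L v)) w =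
        T * localGLPiEquiv L 3 v (g.val : GL (Fin 3) (LocalRing L v)) w * T⁻¹)
      (μN : Measure ↥(unipotentU (conjLocal L (IsCMField.complexConj L) v) (cmLocalForm L 3 v))) [μN.IsHaarMeasure]
      (t : ↥(torusU (conjLocal L (IsCMField.complexConj L) v) (cmLocalForm L 3 v))) (d : Fin 3 → (LocalRing L v)ˣ)
      (hd : glDiagonal 3 (LocalRing L v) d = ((t : ↥(unitaryGroupOfForm (conjLocal L (IsCMField.complexConj L) v) (cmLocalForm L 3 v))) : GL (Fin 3) (LocalRing L v)))
      (_hreg : ∀ i j, i ≠ j → IsUnit ((d i : LocalRing L v) - d j))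
      (ha' : IsUnit ((((d 0)⁻¹ * d 1 : (LocalRing L v)ˣ) : LocalRing L v) - 1)) (hb' : IsUnit ((((d 0)⁻¹ * d 2 : (LocalRing L v)ˣ) : LocalRing L v) - 1))
      (_hdp : deep d) (γ₀ : (cmDatum L 3 H').Local v) (_hγ₀ : ψ γ₀ = (t : ↥(unitaryGroupOfForm (conjLocal L (IsCMField.complexConj L) v) (cmLocalForm L 3 v)))),
      classOrbitalIntegral mG g (ConjClasses.mk γ₀) =
        (νG.real (cmLocalIntegralLevel L 3 H' v : Set ((cmDatum L 3 H').Local v)) : ℂ) * (((letI : MeasurableSpace (LocalRing L v) := borel _; haveI : BorelSpace (LocalRing L v) := ⟨rfl⟩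
          haveI : SecondCountableTopology (LocalRing L v) := secondCountableTopology_localRing (E := L) v
          ((distribHaarChar (LocalRing L v) ha'.unit)⁻¹ *
            (HeisRing.skewModulus (conjLocal L (IsCMField.complexConj L) v) (continuous_conjLocal L (IsCMField.complexConj L) v) hb'.unit
              (HeisRing.map_unit_torusCentralScalar_sub_one (conjLocal L (IsCMField.complexConj L) v) (cmLocalForm_eq_over L 3 v) t hd hb'))⁻¹ :
                ℝ≥0)) : ℝ≥0) : ℂ) * X)
    -- SOCKET C-Δram: the LEVI VALUE of Rogawski's explicit factor near `1`, `Δ‴_v(γ₁, γ₀) = ε·‖a − 1‖` (binders = ★ T5-Levi `finExplicitDelta_eq_unitModulusChar_of_levi_of_nonsplit`'s)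
    (hΔ : ∃ VΔ ∈ 𝓝 (1 : ((cmDatum L 2 (Matrix.of fun i j : Fin 2 => if i.val + j.val + 1 = 2 then (1 : L) else 0)).Local v ×
        (cmDatum L 1 (Matrix.of fun i j : Fin 1 => if i.val + j.val + 1 = 1 then (1 : L) else 0)).Local v)),
      ∀ γH ∈ VΔ, ∀ (y : ((cmDatum L 2 (Matrix.of fun i j : Fin 2 => if i.val + j.val + 1 = 2 then (1 : L) else 0)).Local v ×
        (cmDatum L 1 (Matrix.of fun i j : Fin 1 => if i.val + j.val + 1 = 1 then (1 : L) else 0)).Local v)) (d : Fin 3 → (UnitaryGroup.LocalRing L v)ˣ),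
        ((endoEmbLocal L v (y * γH * y⁻¹)).val : GL (Fin 3) (UnitaryGroup.LocalRing L v)) = glDiagonal 3 (UnitaryGroup.LocalRing L v) d →
        (∀ i j, i ≠ j → IsUnit ((d i : UnitaryGroup.LocalRing L v) - d j)) →
        endoEmbLocal L v (y * γH * y⁻¹) ∈ cmLocalIntegralLevel L 3 (Matrix.of fun i j : Fin 3 => if i.val + j.val + 1 = 3 then (1 : L) else 0) v →
        ∀ (ha : IsUnit ((((d 0)⁻¹ * d 1 : (UnitaryGroup.LocalRing L v)ˣ) : UnitaryGroup.LocalRing L v) - 1)) (γ₀ : (cmDatum L 3 H').Local v),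
          IsLocalNormPair L H' v (y * γH * y⁻¹) γ₀ →
          finExplicitDelta L v H' (y * γH * y⁻¹) μ γ₀ = ε * (((unitModulusChar (UnitaryGroup.LocalRing L v) ha.unit : ℝ≥0) : ℝ) : ℂ))
    -- the coefficient test (only `a₀` is tested on the Levi population at a ramified place: the `χ₁`-row vanishes, ★ p846841)
    (ha : a₀ * (νH.real (((cmLocalIntegralLevel L 2 (Matrix.of fun i j : Fin 2 => if i.val + j.val + 1 = 2 then (1 : L) else 0) v).prod
                (cmLocalIntegralLevel L 1 (Matrix.of fun i j : Fin 1 => if i.val + j.val + 1 = 1 then (1 : L) else 0) v) : Subgroup _) : Set _) : ℂ) =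
      ε * (νG.real (cmLocalIntegralLevel L 3 H' v : Set ((cmDatum L 3 H').Local v)) : ℂ) * X) :
        ∃ V ∈ 𝓝 (1 : ((cmDatum L 2 (Matrix.of fun i j : Fin 2 => if i.val + j.val + 1 = 2 then (1 : L) else 0)).Local v ×
        (cmDatum L 1 (Matrix.of fun i j : Fin 1 => if i.val + j.val + 1 = 1 then (1 : L) else 0)).Local v)),
      ∀ γH ∈ V, IsLocalGRegular L v γH →
        (∃ (y : ((cmDatum L 2 (Matrix.of fun i j : Fin 2 => if i.val + j.val + 1 = 2 then (1 : L) else 0)).Local v ×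
        (cmDatum L 1 (Matrix.of fun i j : Fin 1 => if i.val + j.val + 1 = 1 then (1 : L) else 0)).Local v)) (d' : Fin 2 → (UnitaryGroup.LocalRing L v)ˣ),
          glDiagonal 2 (UnitaryGroup.LocalRing L v) d' = ((y * γH * y⁻¹).1.val : GL (Fin 2) (UnitaryGroup.LocalRing L v))) →
        ∑ᶠ cG : ConjClasses ((cmDatum L 3 H').Local v),
            ((finExplicitCollection L H' μ (finExplicitDelta_conj_left_all L H' μ) (finExplicitDelta_conj_right_all L H' μ)) v).Δ γH (Quotient.out cG) *
              classOrbitalIntegral mG g cG =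
          a₀ * stableOrbitalIntegralRel (IsLocalStablyConjH L v) mH
                ((((cmLocalIntegralLevel L 2 (Matrix.of fun i j : Fin 2 => if i.val + j.val + 1 = 2 then (1 : L) else 0) v).prod
                (cmLocalIntegralLevel L 1 (Matrix.of fun i j : Fin 1 => if i.val + j.val + 1 = 1 then (1 : L) else 0) v) : Subgroup _) : Set _).indicator
              (fun h => if (redMat (((h.1.val : GL (Fin 2) (UnitaryGroup.LocalRing L v)).val.map (Pi.evalRingHom (fun w' : PlacesOver L v => w'.1.adicCompletion L) w))) - 1) ^ 2 = 0 ∧ (redMat (((h.1.val : GL (Fin 2) (UnitaryGroup.LocalRing L v)).val.map (Pi.evalRingHom (fun w' : PlacesOver L v => w'.1.adicCompletion L) w))) - 1).rank = 0 then (1 : ℂ) else 0)) γH +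
          a₁ * stableOrbitalIntegralRel (IsLocalStablyConjH L v) mH
                ((((cmLocalIntegralLevel L 2 (Matrix.of fun i j : Fin 2 => if i.val + j.val + 1 = 2 then (1 : L) else 0) v).prod
                (cmLocalIntegralLevel L 1 (Matrix.of fun i j : Fin 1 => if i.val + j.val + 1 = 1 then (1 : L) else 0) v) : Subgroup _) : Set _).indicator
              (fun h => if (redMat (((h.1.val : GL (Fin 2) (UnitaryGroup.LocalRing L v)).val.map (Pi.evalRingHom (fun w' : PlacesOver L v => w'.1.adicCompletion L) w))) - 1) ^ 2 = 0 ∧ (redMat (((h.1.val : GL (Fin 2) (UnitaryGroup.LocalRing L v)).val.map (Pi.evalRingHom (fun w' : PlacesOver L v => w'.1.adicCompletion L) w))) - 1).rank = 1 then (1 : ℂ) else 0)) γH := by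
  have hcne := IsCMField.complexConj_ne_one L
  haveI : Algebra.IsQuadraticExtension ↥(maximalRealSubfield L) L := IsCMField.isQuadraticExtension L
  have hH'σ : (H'.map (IsCMField.complexConj L))ᵀ = H' := hH'
  have hH'd : IsUnit H'.det := by
    have h := (Matrix.isUnit_iff_isUnit_det _).1 hH'w
    rw [show placeForm H' w.1 = (algebraMap L (w.1.adicCompletion L)).mapMatrix H' from rfl, ← RingHom.map_det] at h
    exact isUnit_iff_ne_zero.2 fun h0 => h.ne_zero (by rw [h0, map_zero])
  have h2w : Valued.v (2 : w.1.adicCompletion L) = 1 := (isUnit_two_integer_iff_valued_eq_one L w.1).1 h2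
  -- §0: the level frame `ψ` from the binder, `(ψ g)_w = A g_w A⁻¹`
  obtain ⟨ψ, hψK, hψc, hψT⟩ := exists_continuousMulEquiv_level_of_frame L H' w hw hH'w A hA hframe
  -- measurable structures on `U(Φ₃)(L⁺_v)` and a Haar measure on `N` (they only feed `hX`)
  haveI : LocallyCompactSpace ↥(unitaryGroupOfForm (conjLocal L (IsCMField.complexConj L) v) (cmLocalForm L 3 v)) := locallyCompactSpace_local (IsCMField.complexConj L) 3 _ v
  haveI : SecondCountableTopology ↥(unitaryGroupOfForm (conjLocal L (IsCMField.complexConj L) v) (cmLocalForm L 3 v)) := secondCountableTopology_local (IsCMField.complexConj L) 3 _ v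
  letI mU : MeasurableSpace ↥(unitaryGroupOfForm (conjLocal L (IsCMField.complexConj L) v) (cmLocalForm L 3 v)) := borel _
  haveI : BorelSpace ↥(unitaryGroupOfForm (conjLocal L (IsCMField.complexConj L) v) (cmLocalForm L 3 v)) := ⟨rfl⟩
  have hN₃ : IsClosed (((unipotentU (conjLocal L (IsCMField.complexConj L) v) (cmLocalForm L 3 v))) : Set ↥(unitaryGroupOfForm (conjLocal L (IsCMField.complexConj L) v) (cmLocalForm L 3 v))) := LineRing.isClosed_unipotentU _ _
  haveI : LocallyCompactSpace ↥(unipotentU (conjLocal L (IsCMField.complexConj L) v) (cmLocalForm L 3 v)) := hN₃.isClosedEmbedding_subtypeVal.locallyCompactSpace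
  obtain ⟨μN, hμN⟩ : ∃ μ : Measure ↥(unipotentU (conjLocal L (IsCMField.complexConj L) v) (cmLocalForm L 3 v)), μ = Measure.haar := ⟨_, rfl⟩
  haveI : μN.IsHaarMeasure := by rw [hμN]; infer_instance
  -- the neighbourhood: deep ∩ (C-Δram's)
  obtain ⟨V, hV1, hVd⟩ := hV
  obtain ⟨VΔ, hVΔ1, hVΔ⟩ := hΔ
  refine ⟨V ∩ VΔ, Filter.inter_mem hV1 hVΔ1, fun γH hγV hreg hlev => ?_⟩
  obtain ⟨y, d', hyd'⟩ := hlev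
  -- the Levi representative `γ₁ = y γ_H y⁻¹`
  have hconj : IsConj γH (y * γH * y⁻¹) := isConj_iff.2 ⟨y, rfl⟩
  have hHC := isLocalStablyConjH_of_isConj_and_conj L γH
  have hst : IsLocalStablyConjH L v γH (y * γH * y⁻¹) := hHC.1 _ hconj
  have hreg₁ : IsLocalGRegular L v (y * γH * y⁻¹) := (isLocalGRegular_conj_iff L y γH).2 hreg
  have hι := endoEmbLocal_eq_glDiagonal_of_fst_eq L v (y * γH * y⁻¹) hyd'
  have hu : (((isUnit_finGammaTwo L v (y * γH * y⁻¹)).unit : (UnitaryGroup.LocalRing L v)ˣ) : UnitaryGroup.LocalRing L v) = finGammaTwo L v (y * γH * y⁻¹) :=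
    (isUnit_finGammaTwo L v (y * γH * y⁻¹)).unit_spec
  obtain ⟨haU, hbU, h12⟩ := isUnit_levi_of_isLocalGRegular_of_nonsplit L w hw hyd' hreg₁
  have hreg3 := isUnit_vecCons_sub_of_levi haU hbU (by rw [hu]; exact h12)
  have hb3 : IsUnit ((((![d' 0, (isUnit_finGammaTwo L v (y * γH * y⁻¹)).unit, d' 1] 0)⁻¹ * ![d' 0, (isUnit_finGammaTwo L v (y * γH * y⁻¹)).unit, d' 1] 2 :
      (UnitaryGroup.LocalRing L v)ˣ) : UnitaryGroup.LocalRing L v) - 1) := hbU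
  -- depth
  have hdp := hVd γH hγV.1 y _ hι
  have ht1 := hdeep1 _ hdp
  have ht1' : ∀ i : Fin 2, Valued.v ((((d' i : (UnitaryGroup.LocalRing L v)ˣ) : UnitaryGroup.LocalRing L v) w) - 1) < 1 := by
    intro i
    fin_cases i
    · exact ht1 0
    · exact ht1 2
  -- the torus element `t = ι_v(γ₁) ∈ T ∩ K₃` and the match `γ₀ = ψ⁻¹ t`
  have ht := endoEmbLocal_mem_torusU_of_endoEmbLocal_eq L v (y * γH * y⁻¹) hι
  obtain ⟨t, ht_eq⟩ : ∃ t : ↥(torusU (conjLocal L (IsCMField.complexConj L) v) (cmLocalForm L 3 v)), (t : ↥(unitaryGroupOfForm (conjLocal L (IsCMField.complexConj L) v) (cmLocalForm L 3 v))) = endoEmbLocal L v (y * γH * y⁻¹) := ⟨⟨_, ht⟩, rfl⟩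
  have hd : glDiagonal 3 (UnitaryGroup.LocalRing L v) ![d' 0, (isUnit_finGammaTwo L v (y * γH * y⁻¹)).unit, d' 1] = ((t : ↥(unitaryGroupOfForm (conjLocal L (IsCMField.complexConj L) v) (cmLocalForm L 3 v))) : GL (Fin 3) (UnitaryGroup.LocalRing L v)) := by
    rw [ht_eq]; exact hι.symm
  have htK : (t : ↥(unitaryGroupOfForm (conjLocal L (IsCMField.complexConj L) v) (cmLocalForm L 3 v))) ∈ cmLocalIntegralLevel L 3 (Matrix.of fun i j : Fin 3 => if i.val + j.val + 1 = 3 then (1 : L) else 0) v := torus_three_mem_cmLocalIntegralLevel_of_deep L w hw t hd ht1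
  have hint : endoEmbLocal L v (y * γH * y⁻¹) ∈ cmLocalIntegralLevel L 3 (Matrix.of fun i j : Fin 3 => if i.val + j.val + 1 = 3 then (1 : L) else 0) v := by rw [← ht_eq]; exact htK
  obtain ⟨γ₀, hγ₀⟩ : ∃ γ₀ : (cmDatum L 3 H').Local v, ψ γ₀ = (t : ↥(unitaryGroupOfForm (conjLocal L (IsCMField.complexConj L) v) (cmLocalForm L 3 v))) := ⟨ψ.symm _, ψ.apply_symm_apply _⟩
  have h₀ : IsLocalNormPair L H' v (y * γH * y⁻¹) γ₀ := by
    have h := hψc γ₀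
    rw [hγ₀, ht_eq] at h
    exact h.symm
  -- the `G` side: ONE term (all matches of `γ₁` are conjugate), `Δ‴ = ε‖a − 1‖` (socket C-Δram), the (O2)-ram socket value
  have hLHS := finsum_delta_mul_classOrbitalIntegral_eq_of_unique
    ((finExplicitCollection L H' μ (finExplicitDelta_conj_left_all L H' μ) (finExplicitDelta_conj_right_all L H' μ)) v) mG g (y * γH * y⁻¹) γ₀
    (fun k hk => isConj_of_isLocalNormPair_of_isLocalNormPair_of_levi L H' hH'σ hH'd (y * γH * y⁻¹) hι hreg3 h₀ hk)
  have hΔv : ((finExplicitCollection L H' μ (finExplicitDelta_conj_left_all L H' μ) (finExplicitDelta_conj_right_all L H' μ)) v).Δ (y * γH * y⁻¹) γ₀ =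
      ε * (((unitModulusChar (UnitaryGroup.LocalRing L v) haU.unit : ℝ≥0) : ℝ) : ℂ) := by
    rw [finExplicitCollection_Δ]
    exact hVΔ γH hγV.2 y _ hι hreg3 hint haU γ₀ h₀
  have hG := hX ψ hψK hψc A hA hψT μN t _ hd hreg3 haU hb3 hdp γ₀ hγ₀
  -- the `H` side at a tame-ramified place (★ p846841): `a₀Φ^st(χ₀) + a₁Φ^st(χ₁) = a₀·ν_H(K_H)·J_H(γ₁)`, decidability instances read off the goal
  have hH := stableOrbitalIntegralRel_chi_combination_of_levi_ramified L v w hw νH he h2w hmH hreg y hyd' ht1' a₀ a₁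
  -- (O4) the prefactor `‖a − 1‖·J₃(t) = J_H(γ₁)` (★ `levi_prefactor_eq`, place-generic unit bookkeeping)
  have hpref := levi_prefactor_eq L v t hd haU hb3 ⟨(y * γH * y⁻¹).1, ⟨d', hyd'⟩⟩ hyd' hbU (by simp)
  -- transport to `γ_H` (`Δ‴` is a stable class function) and close on a token-free scalar goal
  have hsum : (∑ᶠ cG : ConjClasses ((cmDatum L 3 H').Local v), ((finExplicitCollection L H' μ (finExplicitDelta_conj_left_all L H' μ) (finExplicitDelta_conj_right_all L H' μ)) v).Δ γH (Quotient.out cG) * classOrbitalIntegral mG g cG) =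
      ∑ᶠ cG : ConjClasses ((cmDatum L 3 H').Local v), ((finExplicitCollection L H' μ (finExplicitDelta_conj_left_all L H' μ) (finExplicitDelta_conj_right_all L H' μ)) v).Δ (y * γH * y⁻¹) (Quotient.out cG) * classOrbitalIntegral mG g cG :=
    finsum_congr fun cG => by
      rw [finExplicitCollection_Δ_eq_of_isLocalStablyConjH L v H' μ (finExplicitDelta_conj_left_all L H' μ) (finExplicitDelta_conj_right_all L H' μ) hst (Quotient.out cG)]
  refine hsum.trans (hLHS.trans ?_)
  refine Eq.trans ?_ (hH _ _).symm
  refine Eq.trans (congrArg₂ (· * ·) hΔv hG) ?_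
  exact levi_ramified_row_scalar_identity hpref ha

end Literature.NumberTheory.Rogawski1990

end
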